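import Summits.Ventures.PercRepro.Night2T3LinesB

/-!
# PercRepro — the coloop-aware line bound (L5′) (night-2 gen 3, NIGHT-2-profile.md §3g (A))

Every `K` counted by `betaL M G L q` (a `(q−2)`-subset of `G ∖ L` spanning together with `L ∩ G`) contains all the
coloops of `G` when `L` carries `≥ 3` points of `G`: `K ∪ (L ∩ G)` is a spanning subset of `G`, so the coloops of `G`
are coloops of it, and the coloops of `(L ∩ G) ∪ K` are exactly `K` (`coloopsOf_union_eq_of_line`). Hence
`betaL ≤ C(|G ∖ L| − m(G), q − 2 − m(G))` and `B_ℓ ≤ C(|G| − ℓ − m(G), q − 2 − m(G))·N_ℓ` — the bound that makes the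
profile LP grow geometrically in the corank at the bottom of the range (`m(G) = q − 4`).
-/
namespace PercRepro.Star

open Finset ThmH SixFour GenQ

variable {α : Type*} [DecidableEq α] {M : Matroid α} [M.Finite]

/-- A `K` counted by `betaL` on a line with `≥ 3` points of `G` contains every coloop of `G`. -/
theorem coloopsOf_subset_of_betaL (hs : Simple M) {G L K : Finset α} {q : ℕ} (hG : G ⊆ gr M)
    (hrG : M.eRk (G : Set α) = (q : ℕ∞)) (hq : 3 ≤ q) (hL : L ∈ lines M) (hl : 3 ≤ (L ∩ G).card)
    (hK : K ⊆ G \ L) (hKc : K.card = q - 2)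
    (hr : M.eRk ((K ∪ (L ∩ G) : Finset α) : Set α) = (q : ℕ∞)) : coloopsOf M G ⊆ K := by
  have hS : K ∪ (L ∩ G) ∈ Rq M G q :=
    mem_Rq.2 ⟨Finset.union_subset (hK.trans Finset.sdiff_subset) Finset.inter_subset_right, hr⟩
  have h1 := coloopsOf_subset_of_mem_Rq hG hrG hS
  have hdisj : Disjoint K L := Finset.disjoint_left.2 fun x hx => (Finset.mem_sdiff.1 (hK hx)).2
  have h2 : coloopsOf M ((L ∩ G) ∪ K) = K :=
    coloopsOf_union_eq_of_line hs hL Finset.inter_subset_left hl hdisj hKc hq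
      (by rwa [Finset.union_comm])
  rw [Finset.union_comm, h2] at h1
  exact h1

/-- **(L5′), one line**: `betaL ≤ C(|G ∖ L| − m(G), q − 2 − m(G))` when `L` carries `≥ 3` points of `G`. -/
theorem betaL_le_sharp (hs : Simple M) {G L : Finset α} {q : ℕ} (hG : G ⊆ gr M)
    (hrG : M.eRk (G : Set α) = (q : ℕ∞)) (hq : 3 ≤ q) (hL : L ∈ lines M) (hl : 3 ≤ (L ∩ G).card) :
    betaL M G L q ≤ ((G \ L).card - mTr M G).choose (q - 2 - mTr M G) := by
  unfold betaL
  set F := ((G \ L).powersetCard (q - 2)).filter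
    (fun K : Finset α => M.eRk ((K ∪ (L ∩ G) : Finset α) : Set α) = (q : ℕ∞)) with hF
  have hmem : ∀ K ∈ F, K ⊆ G \ L ∧ K.card = q - 2 ∧
      M.eRk ((K ∪ (L ∩ G) : Finset α) : Set α) = (q : ℕ∞) := by
    intro K hK
    rw [hF, Finset.mem_filter, Finset.mem_powersetCard] at hK
    exact ⟨hK.1.1, hK.1.2, hK.2⟩
  rcases Finset.eq_empty_or_nonempty F with hemp | ⟨K₀, hK₀⟩
  · rw [hemp, Finset.card_empty]
    exact Nat.zero_le _
  have hC : coloopsOf M G ⊆ G \ L := by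
    obtain ⟨h1, h2, h3⟩ := hmem K₀ hK₀
    exact (coloopsOf_subset_of_betaL hs hG hrG hq hL hl h1 h2 h3).trans h1
  have hm : mTr M G = (coloopsOf M G).card := rfl
  calc F.card ≤ (((G \ L) \ coloopsOf M G).powersetCard (q - 2 - mTr M G)).card := by
        apply Finset.card_le_card_of_injOn (fun K => K \ coloopsOf M G)
        · intro K hK
          obtain ⟨h1, h2, h3⟩ := hmem K hK
          have hCK := coloopsOf_subset_of_betaL hs hG hrG hq hL hl h1 h2 h3
          rw [Finset.mem_coe, Finset.mem_powersetCard]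
          refine ⟨Finset.sdiff_subset_sdiff h1 (Finset.Subset.refl _), ?_⟩
          rw [Finset.card_sdiff_of_subset hCK, h2, hm]
        · intro K hK K' hK' heq
          obtain ⟨h1, h2, h3⟩ := hmem K hK
          obtain ⟨h1', h2', h3'⟩ := hmem K' hK'
          have hCK := coloopsOf_subset_of_betaL hs hG hrG hq hL hl h1 h2 h3
          have hCK' := coloopsOf_subset_of_betaL hs hG hrG hq hL hl h1' h2' h3'
          have e1 := Finset.sdiff_union_of_subset hCK
          have e2 := Finset.sdiff_union_of_subset hCK'
          simp only at heq
          rw [← e1, ← e2, heq]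
    _ = ((G \ L).card - mTr M G).choose (q - 2 - mTr M G) := by
        rw [Finset.card_powersetCard, Finset.card_sdiff_of_subset hC, hm]

/-- **(L5′)**: `B_ℓ ≤ C(|G| − ℓ − m(G), q − 2 − m(G))·N_ℓ` for `ℓ ≥ 3`. -/
theorem Bl_le_sharp (hs : Simple M) {G : Finset α} {q l : ℕ} (hG : G ⊆ gr M)
    (hrG : M.eRk (G : Set α) = (q : ℕ∞)) (hq : 3 ≤ q) (hl : 3 ≤ l) :
    Bl M G q l ≤ (G.card - l - mTr M G).choose (q - 2 - mTr M G) * Nl M G l := by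
  unfold Bl Nl
  rw [Finset.card_eq_sum_ones ((lines M).filter (fun L : Finset α => (L ∩ G).card = l)), Finset.mul_sum]
  apply Finset.sum_le_sum
  intro L hL
  have hL' := Finset.mem_filter.1 hL
  have h := betaL_le_sharp hs hG hrG hq hL'.1 (hL'.2 ▸ hl)
  have hsd : (G \ L).card = G.card - (L ∩ G).card := by
    have h2 := Finset.card_sdiff_add_card_inter G L
    rw [Finset.inter_comm] at h2
    omega
  rw [hsd, hL'.2] at h
  rw [mul_one]
  exact h

end PercRepro.Star
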